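import Literature.NumberTheory.EllipticCurves.Kobayashi2003.SignedSelmer
import Literature.NumberTheory.EllipticCurves.Rank1Residual.Predicates
import Summits.BirchSwinnertonDyer.Rank1Residual.F1Sign2.HondaSystemAtTwo
import HarnessLib

/-!
# The SIGNED-SPAN DEFECT at `(2, a₂ = ±2)` along the cyclotomic `ℤ₂`-tower, in the cell's house style — C1′ floor law, C6 per-layer defect, C5 injectivity,
# C3± meet (cell `bsd-f1-sign2`, «what is the signed / ± object at 2?»; -imc g20 D-imc-60 `Sketch63.lean` 34c852154dcd0c69 → 9c3690a8639523cd = MEMO-imc §10.100-add3 (b)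
# + add4 (closed form), with add1/add2; REF1-AUDIT §228 (Sketch61) + §228b/§230/§233 (Sketch63); REF2-PLACEMENT-v57 §3 + ERRATUM 18:27Z + v58 §6; typer -ty g20;
# v2 = v1 p738666 + the REF2 v58 §6 one-sentence rider on C5/C3± («no 2-torsion in the tower is a lemma» ⇒ C5, C3± unconditional in substance), docstring-only, bodies byte-identical;
# v3 = v2 p741321 + REF1 §245 / REF2 v58-add3 §I fold (-imc PROOF.md audited: C1′/C6 proved on paper modulo HondaSystemAtTwoExists-with-generation, torsion proviso dropped;
# C5/C3± theorems on paper outright), docstring-only, bodies byte-identical)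

STATEMENTS ONLY (plain support `def … : Prop` over tree declarations — -imc add3 FILING ADVICE «one file `F1Sign2/SignedSpanDefectAtTwo.lean` = Sketch63 verbatim as plain
support defs (nothing asserted), bears_on the sign2 node» — plus -imc's kernel-decided arithmetic lemmas (`exponents_values`, `floor_eq_normB_valuation` — `extrapolation_parts_at_eight` is the
already-landed `SignedSubgroupsAtTwo.Kernel.signedSpanIndexLaws_agree_le_seven`, not restated; add4: `exponent_closed_form` — `Σ_{m≤n}⌊2^m/15⌋ = (2^{n+1} − 2^{(n+1) mod 4})/15 − ⌊(n+1)/4⌋`, n ≤ 40, concurred by REF1 §230 —, `sdim_values`,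
`no_iwasawa_fit` — no integers `μ, λ, ν` fit `μ·2ⁿ + λ·n + ν` at n = 8, 9, 10: the defect modules do not grow like co-invariants of a torsion Iwasawa module); no `sorry`, no instance, no named fact; the typer's
glue theorems (C5 ∧ C6 ⟹ C1′ PROVED, the `a₂ = 0` span from `SignedDecompositionAtTwo`, the all-types meet, C1′ truncation) live in the sibling
`SignedSpanDefectAtTwoKernel.lean`).  BSD is not proved by this; 23715 is not closed by this.

PLACEMENT INSIDE THE CELL / DEDUP (-imc add3 (a); REF2 v57 ERRATUM).  The load-bearing input «(B2)@2» (`Ê(ℚ_{2,m}) = ℤ₂[G]d_m + ℤ₂[G]d_{m−1}` with the three-term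
Honda recursion, all three supersingular types) IS ALREADY TYPED: `F1Sign2.HondaSystemAtTwoExists` (`F1Sign2/HondaSystemAtTwo.lean`, D-imc-47, -ty g12; Sprung 2012
Thm. 2.2 in `ℤ₂`-tower form at `p = 2`, generation clause in dual form; census `s_A = s_B = 0` to n = 8 / 7 by three engines, REF1 §133) [cite: Sprung2012, Thm. 2.2, Lemma 2.3],
descended from `k_n = ℚ₂(ζ_{2^{n+2}})` to `ℚ_{2,n}` by `F1Sign2.DeltaTraceSurjectiveAtTwo` (= [cite: Kramer1981, Prop. 4] at n = 0; not stated in print for n ≥ 1) — so REF2 v57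
§3.3 (1)'s «type (B2)@2 as the crux `HondaTwoGenerationAtTwo`» is WITHDRAWN (erratum), and [cite: Pollack2005, Thm. 3.1] (`p` odd, `ℚ_{n,p}`) /
[cite: KuriharaOtsuki2006, Prop. 1.4] (norm-index bound only) are the neighbouring print.  The `a₂ = 0` statements — Sketch61's C2 `E⁺ + E⁻ = E` and the `a₂ = 0` half
of C3 `E⁺ ∩ E⁻ = E(ℚ₂)` — ARE `F1Sign2.SignedDecompositionAtTwo` (same file, (C3-47)) and are NOT restated here; the typer's earlier port `F1Sign2/SignedSubgroupsAtTwo.lean`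
(p737686, Sketch61 VERBATIM over the `ℚ_[2]` carrier, filed one minute after add3 and before reading it) carries them as `SignedSubgroupsAtTwo.SignedSpanAtTwoOfTraceZero` /
`SignedSubgroupsAtTwo.SignedMeetAtTwo` — DUPLICATES in lattice language of (C3-47), recorded as such (CANDIDATES.md pass 156; that file's next touch adds the dedup
note); the kernel sibling here derives the lattice form from (C3-47) (`Kernel.span_eq_layer_of_signedDecomposition`), so nothing rests on the duplicate.  Sketch63's C4 `DoubleTraceDivisibleAtTwo` / C4a `TraceTwoLayersDownModTwoAtTwo` are the SAME statements as p737686's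
`SignedSubgroupsAtTwo.DoubleTraceDivisibleAtTwo` / `…TraceTwoLayersDownModTwoAtTwo` modulo the carrier (`v.adicCompletion ℚ` at `v ∋ 2` vs `ℚ_[2]`); they are NOT re-filed here —
those (REF1 §228-audited, REF2 v57-placed: corollaries of (B2)@2, sharper exact form `Tr_{n+2/n}Ê(K_{n+2}) = 2Ê(K_n)` recommended to -imc) are the rows of record.
PRIORITY (add3 (a)(iii)): the raw defect values `[Ê : E⁺ + E⁻] = 2¹, 2³, 2⁷, 2¹⁵` at n = 4..7 for `a₂ = ±2` were FIRST RECORDED by REF1 §133 (2026-08-28, fifth engine,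
«hypothesis mutation: `frobeniusTrace 2 = 0` is load-bearing for (C3-47)»); D-imc-60 adds the closed form, its derivation, the deciding datum n = 8, the per-layer /
injectivity structure, the `𝔽₂[x]`-type of the defect module, the explicit norm-twisted generators and the atlas identifications.

OBJECTS (TREE carriers, `Literature/NumberTheory/EllipticCurves/Kobayashi2003/SignedSelmer.lean`, through the abbrevs at the place `v ∋ 2` of `ℚ` — the convention of
`HondaSystemAtTwo.lean` / `SupersingularTowerNormIndexAtTwo.lean`): `E(ℚ_{2,n})` = `localLayerPoints κ (v.adicCompletion ℚ) W n`; Kobayashi's `E^±_n` =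
`signedLocalPoints κ (v.adicCompletion ℚ) W (±1) n` (Def. 1.1 VERBATIM on the `ℤ₂`-tower: trace conditions at all layers `m < n` of parity `(−1)^m = ±1`)
[cite: Kobayashi2003, Def. 1.1]; `Tr_{n/m}` = `localTrace κ (v.adicCompletion ℚ) W m n`; `GoodSS W 2` = good reduction ∧ `2 ∣ a₂` (at `2`: supersingular, `a₂ ∈ {0, ±2}`).

ROWS (Sketch63 VERBATIM; ranks = -imc's):
* C1′ `SignedSpanIndexFloorLawAtTwo` — `a₂ = ±2`: `[E(ℚ_{2,n}) : E⁺_n + E⁻_n] = 2^(Σ_{m ≤ n} ⌊2^m/15⌋)` (log₂-index 0,0,0,1,3,7,15,32,66,134 for n = 1..10).  It SUPERSEDES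
  Sketch61's C1 `SignedSpanIndexLawAtTwo` (`2^(2^(n−3) − 1)`, read off n ≤ 7), REFUTED-MISSTATED at n = 8 by its registered falsifier kit j334501 (engine L, 1400 bits:
  log₂-index **32** for both signs (add2), = the value -imc PRE-REGISTERED from the derivation at 18:02:31Z, ≠ 31) — C1 is typed nowhere (CANDIDATES: KILLED; the landed kernel
  lemma `SignedSubgroupsAtTwo.Kernel.signedSpanIndexLaws_agree_le_seven` decides agreement for n ≤ 7 and `31 ≠ 32`).  DERIVATION (add1 (a)–(e); REF2 v57 §3.1 derived the same law INDEPENDENTLY before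
  reading add1): covolume reduction to the top isotypic component `V_m ≅ ℚ₂(ζ_{2^m})`; `(d_k)_j = b_{k−j}(d_j)_j` with `b_0 = 1, b_1 = a₂/2, 2b_{k+1} = a₂ b_k − b_{k−1}`; for
  `a₂ = ±2`, `b_k = 0 ⟺ k ≡ 3 (mod 4)`; CRT in `ℤ₂[G]`; `v_π(Φ_{2^j}(ζ_{2^m})) = 2^{j−1}`; whence the per-layer defect `δ_m = ⌊2^m/15⌋ = Σ_{1 ≤ j < m, j ≡ m+1 (4)} 2^{j−1}` (the
  in-file lemma `floor_eq_normB_valuation` decides this identity for m ≤ 12) and `i_n = Σ_{m ≤ n} δ_m`.  REF2 R57a: the mod-2 atlas identity `ℓ_k = t_{k+2}` verified k = 2..7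
  (1,2,4,8,17,34), so `i₉ = 66` is already certified; R228b (REF1): the index depends on `W` ONLY THROUGH `a₂` (two Honda formal groups `T² ∓ 2T + 2` along one tower).
  THE HONEST CRUX ROW (add3 FILING ADVICE; not a `def` — an implication between named nodes, the prover target): «`HondaSystemAtTwoExists` ∧ (no `2`-torsion in
  `E(ℚ_{2,n})`) ⟹ `SignedSpanIndexFloorLawAtTwo`» — pure algebra in `ℤ₂[G]`, no literature dependence beyond the cyclotomic valuations and CRT.
* C6 `SignedTopDefectAtTwo` (the PER-LAYER form; REF1 §228 R228d asked for it) — `[E(ℚ_{2,n+1}) : E⁺_{n+1} + E⁻_{n+1} + E(ℚ_{2,n})] = 2^⌊2^{n+1}/15⌋` (δ = 0,0,0,1,2,4,8,17 for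
  n+1 = 1..8); C5 `SignedDefectInjectsAtTwo` (all three types) — `(E⁺_n + E⁻_n) ∩ E(ℚ_{2,m}) = E⁺_m + E⁻_m` for `m ≤ n` (the defect modules INJECT up the tower; REF2 §3.1 (i)
  = the FILTRATION property).  **C5 ∧ C6 ⟹ C1′ is PROVED** in the kernel sibling (`Kernel.floorLaw_of_injects_of_topDefect`: `[E_{n+1} : S_{n+1}] = [E_{n+1} : S_{n+1} + E_n]
  · [E_n : S_{n+1} ∩ E_n]`, second isomorphism theorem + C5, base `E^ε_0 = E(ℚ₂)`), so C1′ reduces to the two layer-local rows — REF2's «type C6 and C5 as the primary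
  statements, C1′ as their corollary».
* C3± `SignedMeetAtTwoOfTraceNeZero` — the `a₂ ≠ 0` complement of (C3-47)'s meet clause: `E⁺_n ∩ E⁻_n = E(ℚ₂)` for `a₂ = ±2` (REF1 §228 R228c: THEOREM IN SUBSTANCE —
  isotypic reading + `E(ℚ_{2,n})[2] = 0` saturation, Kobayashi 8.12 (i) verbatim [cite: Kobayashi2003, Prop. 8.12]; REF2: elementary in the frame, needs
  [cite: Sprung2012, Lemma 2.3]); with (C3-47) the kernel gives the meet for all three types (`Kernel.meet_eq_layer_zero_of_rows`).
BC7 / BINDERS: -imc Probe63 6/6 CLEAN; REF1 §228 (on the Sketch61 forms): `H.relIndex K = [K : H ⊓ K]` orientation correct, `localTrace m n = Tr_{n/m}`, ℕ-division/truncation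
exponent `0` for `n ≤ 3` (kernel `floorLaw_span_of_le_three`), content from `n = 2` (BC7-e), `κ.IsCyclotomic` redundant over `ℚ` but harmless; CHOICE OF TOWER (§228 4(iv)): the
`ℤ₂`-tower reading, consistently (the `μ`-tower variant is a different statement).  REF1-AUDIT §228b (Sketch63 34c8; = 9c36 bodies 6/6, §230) VERDICTS: C1′, C6 SURVIVE as theorem-candidates modulo `HondaSystemAtTwoExists` + `E(ℚ_{2,n})[2] = 0`
(REF1's independent ENGINE M — exact-HNF lattice model of (B2) + Honda traces — reproduces `i_n = 0,0,0,1,3,7,15,32`, both signs, and kills C1 a third time); C5 and C3±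
are THEOREMS IN SUBSTANCE modulo `E(ℚ_{2,n})[2] = 0` only (R228e modular law; R228c′ downward induction); REF1 §230: this port 4/4 IDENTICAL, C4/C4a rightly dropped, kernel
`floorLaw_of_injects_of_topDefect` = R228e's factorisation in kernel form (needs no torsion hypothesis), PLAIN tags accepted.  WHAT IS (NOT) ESTABLISHED (§228b item 6):
numerically by three code-independent engines the defect values through n = 8; on paper (REF1 concurring with -imc add1 and REF2 v57) (B2) + Honda trace relation +
`E_n[2] = 0` ⟹ C6 ⟹ (with C5) C1′ and ⟹ C4/C4a, `E_n[2] = 0` ⟹ C5, C3±; NOT established: (B2) = `HondaSystemAtTwoExists` at `p = 2` for `a₂ = ±2` beyond the census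
(the single load-bearing input).

DATA = BC5 WITNESS (MEMO-imc §10.100 / add1 / add2; bundle `HOME/MEMO-imc-data/dimc60/` SHA16SUMS; numbers not adjectives): engine P = `engine/k60.gp` 4de43f09056134cb (curve
points + formal logarithm; 19a1, 35a1 (`a₂ = 0`), 67a1 (`a₂ = 2`), 11a1 (`a₂ = −2`); layers 3, 4, 5 = kit j334335 / j334336 / j334400) and engine L = `an/i_n.py`
78e89c00584ad87a (Honda log model, n ≤ 8, kit j334501), agreeing on every shared cell; log₂`[E : E⁺ + E⁻]` = 0 (`a₂ = 0`, n ≤ 8) and 0,0,0,1,3,7,15,32 (`a₂ = ±2`, n = 1..8, both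
signs; layer 5 from points `i₅ = 0,0,3,3`); quotients `ℤ/2, (ℤ/2)³, (ℤ/2)⁵ ⊕ ℤ/4` (n = 4..6), `Q₇/2Q₇ ≅ 𝔽₂[x]/x⁸ ⊕ 𝔽₂[x]/x⁴`; `E⁺ ∩ E⁻` rank 1 all types (n ≤ 8 log model; 3, 4, 5
points); C5: `inj.py` n = 6 (log₂-indices 0,0,0,0,1,3 = i_m), `qstruct` (4,2), (8,4); C6: `topidx.py` δ = 0,0,0,1,2,4 (m ≤ 6), `i_7 − i_6 = 8`, `i_8 − i_7 = 17`.

PRINT / PLACEMENT (REF2-PLACEMENT-v57 §3, af4e22a98e1c31e7, + ERRATUM 18:27Z): C1′/C5/C6 NOT IN PRINT (statement or phenomenon) — nearest [cite: Sprung2013, p. 7] («for the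
case `a_p = 0`, Kobayashi was able to decompose … this seems to be very hard in the case `a_p ≠ 0` … we bypass this decomposition») [corpus:paper:arxiv-1106.1936 p0007 L39],
[cite: Sprung2012, Open Problem 7.22], [cite: KuriharaOtsuki2006, p. 1] (the `a₂ ≠ 0` paper; ± groups mentioned only for `a₂ = 0`); `a_p ≠ 0` is always handled in print via
♯/♭ = Coleman/Wach duality, never by computing the ± span; barrier `Literature/Barriers/BirchSwinnertonDyer/IwasawaTheoryAtTwo.lean` (`SignedIwasawaTheoryAtTwoBarrier`: every
ALGEBRAIC signed source assumes `p` odd).  GRADE: corollaries of `HondaSystemAtTwoExists` (theorem-candidates modulo that typed, unproved port-of-print input and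
`E(ℚ_{2,n})[2] = 0`), **beyond print: YES-small** (an exact law for the FAILURE of Kobayashi's decomposition at `(2, ±2)` — the local shape any ±-theory at `2` must start
from); two independent pen-and-paper derivations + data n ≤ 8; C3± in print in substance.  REF2 R57b: parity is the optimal `ℤ/2`-grading at `(2, ±2)` and still not exact; R57c
(lens offer, not typed — no sketch): the period-4 «quarter-signed» trace groups `E^{[r]}_n` span EXACTLY under (B2)@2.  PARTITION: none moved.  Beyond-print theorem: no.
bears_on: stmt-BirchSwinnertonDyer-23715 (the sign2 node; no route consumes these rows yet).
-/

set_option autoImplicit false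

open scoped NumberField

open WeierstrassCurve Literature.NumberTheory.EllipticCurves
  Literature.NumberTheory.EllipticCurves.Rank1Residual
  Literature.NumberTheory.EllipticCurves.Kobayashi2003 ZpExtension NumberField IsDedekindDomain

namespace Summit.BirchSwinnertonDyer.Rank1Residual.F1Sign2.SignedSpanDefect

/-- **C1′ · `SignedSpanIndexFloorLawAtTwo`** (candidate, rank 2 of the D-imc-60 set; BC5 witness = the census
log₂-index 0,0,0,1,3,7,15,32 at n = 1..8, both signs, two engines at n = 3, 4, 5).  For `W/ℚ` globally minimal with
good supersingular reduction at `2` and `a₂ ≠ 0`, the cyclotomic `ℤ₂`-extension `κ` and the place `v ∋ 2`: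
`[E(ℚ_{2,n}) : E⁺_n + E⁻_n] = 2 ^ (Σ_{m ≤ n} ⌊2^m/15⌋)` for every `n`.
Why it might fail: it is DERIVED from the two-generation of `Ê(ℚ_{2,m})` by consecutive Honda points for a₂ = ±2
(`HondaSystemAtTwoExists`, numerically exact to n = 7/8 but not a theorem) and from `E(ℚ_{2,n})[2] = 0`.
Sources: Kobayashi2003 Def. 1.1, §8; Sprung2012 Thm. 2.2; Sprung 2013 (arXiv:1106.1936) p. 7 («very hard in the case
a_p ≠ 0 … we bypass this decomposition»); KuriharaOtsuki2006 Prop. 1.4.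
(RIDER, typer -ty g20: PLAIN support `def` per -imc add3 FILING ADVICE — a corollary of the typed input `F1Sign2.HondaSystemAtTwoExists` (the crux row is the
implication, see the module docstring); REF1-AUDIT §228b (-ref1 g21, 18:30Z; `REF1-data/b228b/Probe228b.lean` d11823eb94b1d3c4 rc 0, BC7 h–m sorry-free; bodies = Sketch63 9c36 6/6 IDENTICAL, §230): **SURVIVES A1–A6 + BC7 as a
theorem-candidate modulo (B2)@2 = `F1Sign2.HondaSystemAtTwoExists` + `E(ℚ_{2,n})[2] = 0`**; REF1 re-derived add1 (a)–(c) line by line (R228f, two precisions: the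
conditions are indexed by `j ≥ 1` only — the `V_0 = E(ℚ₂)` direction is never constrained, which `⌊2^m/15⌋` encodes by flooring away the would-be `j = 0` term; and
`|B| = 2` first happens at `m = 8`, `B = {5, 1}`, `δ₈ = 16 + 1` — the «+1» = `v_π(ζ₂₅₆ + 1)` is exactly the unit by which 32 beats 31) and CONFIRMED the numbers by an
independent THIRD ENGINE M (exact integer HNF of the (B2)+Honda-trace isotypic lattice model, `model228b.py` 26590ac4b70f7192: `i_n = 0,0,0,1,3,7,15` exact n ≤ 7,
`i₈ = 32` 2-adically, both signs; `a₂ = 0`: 0; (B2)-coherence of the model at every level); BC7-h `extrapolated_false_of_floorLaw` (C1 and C1′ cannot both hold: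
`2^32 ≠ 2^31`), BC7-l truncation (n ≤ 3 ⇒ full span).  R228e: **C1′ ⟺ C6 given `E(ℚ_{2,n})[2] = 0`** (Dedekind's modular law; the whole (B2)-content sits in C6).
Grade: PLAIN support `def` (REF1 §230 item 4: no objection; the cell's `@[conjecture]`-or-plain call left to the typer — plain per -imc add3).  REF1 §228 R228b: depends on `W` only through `a₂`; BC7-e: content from `n = 2`; ℕ-division: exponent `0` for
`n ≤ 3` (kernel `floorLaw_span_of_le_three`).  SUPERSEDES Sketch61's C1 `SignedSpanIndexLawAtTwo` (REFUTED-MISSTATED at n = 8: kit j334501 returned 32 =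
Σ_{m≤8}⌊2^m/15⌋, pre-registered by -imc 18:02:31Z, ≠ 31; landed kernel lemma `SignedSubgroupsAtTwo.Kernel.signedSpanIndexLaws_agree_le_seven`).  REF2-PLACEMENT-v57 §3 (af4e22a98e1c31e7) + ERRATUM 18:27Z: NOT IN
PRINT (statement or phenomenon); nearest [cite: Sprung2013, p. 7], [cite: Sprung2012, Open Problem 7.22], [cite: KuriharaOtsuki2006, p. 1]; corollary of (B2)@2 =
`HondaSystemAtTwoExists` [cite: Sprung2012, Thm. 2.2] ([cite: Pollack2005, Thm. 3.1] is the `p`-odd neighbour); beyond print YES-small; REF2 derived the law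
INDEPENDENTLY (§3.1: filtration + top-coefficient ideal `𝒜_m = Ψ_{J₁}R + 2R + Ψ_{J₂}R`, `t_m = ⌊2^m/15⌋`) and adds R57a (`ℓ_k = t_{k+2}`, verified k = 2..7 ⇒ `i₉ = 66`
certified), R57b, R57c; «type C6 and C5 as the primary statements, C1′ as their corollary» — done: kernel `floorLaw_of_injects_of_topDefect` PROVES C5 ∧ C6 ⟹ C1′.
Sources as tags: [cite: Kobayashi2003, Def. 1.1, §8] [cite: Sprung2012, Thm. 2.2] [cite: Sprung2013, p. 7] [cite: KuriharaOtsuki2006, Prop. 1.4].  REF1-AUDIT §245 + REF2 v58-add3 §I (v3 fold, typer -ty g20): -imc's `MEMO-imc-data/dimc60/PROOF.md` 3a169f71cdd153d6 (log₂[Λ_n : E⁺_n + E⁻_n] =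
Σ_{m≤n}⌊2^m/15⌋, [Λ_n : E⁺_n + E⁻_n + Λ_{n−1}] = 2^{⌊2^n/15⌋}; steps 0–5) was audited line by line by REF1 (pen-and-paper; elementary inputs machine-checked; lattice law
confirmed at n = 9 by REF1's ENGINE M: 66) and read in full by REF2 — VERDICT: COMPLETE and CORRECT modulo (I1) = `HondaSystemAtTwoExists` read WITH its generation clauses;
(I2) (torsion-free, invariants) is AUTOMATIC (R245a: supersingular at 2 and 3 ∤ e(ℚ_{2,n}/ℚ₂) ⟹ E(ℚ_{2,n})[2] = 0 by the height-2 Newton polygon) — so this row is **PROVED ON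
PAPER modulo `HondaSystemAtTwoExists`-with-generation; the torsion proviso is DROPPED**; statement NOT in print (beyond-print theorem-candidate conditional on (I1)).) -/
def SignedSpanIndexFloorLawAtTwo : Prop :=
  ∀ (W : WeierstrassCurve ℚ) [W.IsElliptic] [W.IsGloballyMinimal], GoodSS W 2 → W.frobeniusTrace 2 ≠ 0 →
  ∀ (κ : ZpExtension ℚ 2), κ.IsCyclotomic →
  ∀ (v : HeightOneSpectrum (𝓞 ℚ)), (2 : 𝓞 ℚ) ∈ v.asIdeal →
  ∀ n : ℕ,
    (signedLocalPoints κ (v.adicCompletion ℚ) W 1 n ⊔ signedLocalPoints κ (v.adicCompletion ℚ) W (-1) n).relIndex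
      (localLayerPoints κ (v.adicCompletion ℚ) W n) = 2 ^ ((Finset.range (n + 1)).sum fun m => 2 ^ m / 15)

/-- **C6 · `SignedTopDefectAtTwo`** (candidate, rank 3; the per-layer form: C5 ∧ C6 ⟹ C1′).  Same hypotheses:
`[E(ℚ_{2,n+1}) : E⁺_{n+1} + E⁻_{n+1} + E(ℚ_{2,n})] = 2 ^ ⌊2^(n+1)/15⌋` — the defect created at layer `n+1` lives in the
top isotypic component and equals `v_π` of the gcd of the two norm elements `N_A`, `N_B` of the derivation.
Census: δ_m = 0,0,0,1,2,4,8,17 (m = 1..8; topidx.py m ≤ 6 directly, i_m − i_{m−1} to 8).  Why it might fail: as C1′.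
(RIDER, typer -ty g20: PLAIN; the per-layer form REF1 §228 item 6 (R228d) asked for — falsifiable layer by layer (next: δ₉ = 34 already certified via REF2 R57a
`ℓ₇ = 34`, δ₁₀ = 68); REF1-AUDIT §228b: **SURVIVES as a theorem-candidate modulo (B2)@2 + `E(ℚ_{2,n})[2] = 0`** (same status as C1′; engine M: `δ_n = 0,0,1,2,4,8 = ⌊2ⁿ/15⌋` for
n = 2..7, `a = ±2`, 18/18); BC7-k: at `n + 1 = 1` it holds BY DEFINITION on the v-adic carrier too (`E⁻_1 = E(ℚ_{2,1})`, index `1 = 2^⌊2/15⌋`), and the exponent `0`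
at `n + 1 = 2, 3` is a genuine full-span claim — content from `n + 1 = 2`.  Cheap next falsifier (REF1 ask to -imc, engine L): n = 9, 10 ⇒ 66, 134 (C1-type
extrapolations differ: 63, 127); `i₉ = 66` is already certified by REF2 R57a (`ℓ₇ = 34`).  Grade: PLAIN support `def` (§230).  Kernel: C5 ∧ C6 ⟹ C1′ (`floorLaw_of_injects_of_topDefect`); exponents `⌊2^(k+1)/15⌋` and their partial sums = C1′'s
(`exponents_values` below, -imc, `decide`).  REF2 v57 §3.1 (i)/§3.2: C6 = the intrinsic per-layer defect `t_m`; NOT IN PRINT; corollary of `HondaSystemAtTwoExists`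
[cite: Sprung2012, Thm. 2.2]; beyond print YES-small.  REF1-AUDIT §245 + REF2 v58-add3 §I (v3 fold, typer -ty g20): -imc's `MEMO-imc-data/dimc60/PROOF.md` 3a169f71cdd153d6 (log₂[Λ_n : E⁺_n + E⁻_n] =
Σ_{m≤n}⌊2^m/15⌋, [Λ_n : E⁺_n + E⁻_n + Λ_{n−1}] = 2^{⌊2^n/15⌋}; steps 0–5) was audited line by line by REF1 (pen-and-paper; elementary inputs machine-checked; lattice law
confirmed at n = 9 by REF1's ENGINE M: 66) and read in full by REF2 — VERDICT: COMPLETE and CORRECT modulo (I1) = `HondaSystemAtTwoExists` read WITH its generation clauses;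
(I2) (torsion-free, invariants) is AUTOMATIC (R245a: supersingular at 2 and 3 ∤ e(ℚ_{2,n}/ℚ₂) ⟹ E(ℚ_{2,n})[2] = 0 by the height-2 Newton polygon) — so this row is **PROVED ON
PAPER modulo `HondaSystemAtTwoExists`-with-generation; the torsion proviso is DROPPED**; statement NOT in print (beyond-print theorem-candidate conditional on (I1)).) -/
def SignedTopDefectAtTwo : Prop :=
  ∀ (W : WeierstrassCurve ℚ) [W.IsElliptic] [W.IsGloballyMinimal], GoodSS W 2 → W.frobeniusTrace 2 ≠ 0 →
  ∀ (κ : ZpExtension ℚ 2), κ.IsCyclotomic →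
  ∀ (v : HeightOneSpectrum (𝓞 ℚ)), (2 : 𝓞 ℚ) ∈ v.asIdeal →
  ∀ n : ℕ,
    (signedLocalPoints κ (v.adicCompletion ℚ) W 1 (n + 1) ⊔ signedLocalPoints κ (v.adicCompletion ℚ) W (-1) (n + 1) ⊔
        localLayerPoints κ (v.adicCompletion ℚ) W n).relIndex
      (localLayerPoints κ (v.adicCompletion ℚ) W (n + 1)) = 2 ^ (2 ^ (n + 1) / 15)

/-- **C5 · `SignedDefectInjectsAtTwo`** (candidate, rank 4; all three types).  The signed span meets every lower
layer in that layer's signed span: `(E⁺_n + E⁻_n) ∩ E(ℚ_{2,m}) = E⁺_m + E⁻_m` for `m ≤ n` — equivalently the defect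
modules `Q_m = E(ℚ_{2,m})/(E⁺_m + E⁻_m)` INJECT along the tower (for a₂ = 0 both sides are `E(ℚ_{2,m})`).
Census: inj.py n = 6 (log₂-indices 0,0,0,0,1,3 = i_m), qstruct n = 6, 7 (𝔽₂[x]-types (4,2), (8,4)).
Why it might fail: `⊇` is formal (`E^±_m ≤ E^±_n`); `⊆` needs that a sum `P⁺ + P⁻` fixed by `Gal(ℚ_{2,n}/ℚ_{2,m})`
has summands correctable inside `E^±_n` — true in the isotypic model with no 2-torsion, could fail integrally only
through a 2-torsion phenomenon (excluded: `E(ℚ_{2,n})[2] = 0`).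
(RIDER, typer -ty g20: PLAIN; REF1-AUDIT §228b R228e: **SURVIVES and is a THEOREM IN SUBSTANCE modulo `E(ℚ_{2,n})[2] = 0` ONLY — (B2) is NOT needed**: with `ε = (−1)ⁿ`, (α) `E^{−ε}_n =
E^{−ε}_{n−1}` and (β) `E^{ε}_n ∩ E_{n−1} = E^{ε}_{n−1}` by 2-saturation (`2Q ∈ E_{m'}`, `Q ∈ E_{m'+1}` ⇒ `σQ − Q ∈ E[2] = 0`), then (γ) Dedekind's modular law
(`B ≤ C ⇒ (A + B) ∩ C = (A ∩ C) + B`) gives `S_n ∩ E_{n−1} = S_{n−1}`, induct down; engine M 81/81 triples; BC7-i/j: at `m = n` and `m = 0` it holds OUTRIGHT (content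
for `0 < m < n`).  So the rider sentence of Sketch62 «support-level given (B2)» is CORRECTED to «given `E(ℚ_{2,n})[2] = 0`», and the sketch's own «could fail integrally
only through a 2-torsion phenomenon (excluded)» is exactly right.  Portable as a PROVER TARGET now; tree lemmas a prover needs (REF1): trace transitivity
`localTrace m n = localTrace m k ∘ localTrace k n` on `E_n`, `localTrace n (n+1) P = 2 • P` for `P ∈ E_n` (today only `index ∣ 2^(n+1)`), `localTraceOfEmb_self_of_mem`,
a no-2-torsion hypothesis, and the modular law (Mathlib `IsModularLattice` via `AddSubgroup.toIntSubmodule`).  Grade: PLAIN support `def` (§230).  REF2 v57 §3.1 (i): = the FILTRATION property `S_n ∩ K_m = S_m`; NOT IN PRINT; corollary of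
`HondaSystemAtTwoExists` [cite: Sprung2012, Thm. 2.2]; for `a₂ = 0` both sides are the whole layer by `SignedDecompositionAtTwo` (kernel
`span_eq_layer_of_signedDecomposition`).  REF2-PLACEMENT-v58 §6 (v2 fold, typer -ty g20): the «no 2-torsion in the tower» hypothesis `E(ℚ_{2,n})[2] = 0` is a LEMMA, not an
input — for good supersingular reduction at 2 inertia acts on `W[2]` through the level-2 fundamental character of order 3 [cite: Conrad1997Flat, Thm. 1.1]
[cite: CalegariEmerton2009, Lemma 13], so `W[2](K) = 0` for every `K/ℚ₂` whose ramification index is prime to 3 — all layers `ℚ_{2,n}` (`e = 2ⁿ`); equivalently the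
Newton-polygon remark above or `#Ẽ(𝔽₂) = 3 − a₂` odd + formal group — hence this row is a **THEOREM IN SUBSTANCE, UNCONDITIONALLY** (C1′/C6/C4/C4a remain «modulo
(B2)@2 = `HondaSystemAtTwoExists`» only).  REF1-AUDIT §245 R245a (v3 fold): with (I2) automatic and PROOF.md Remark (iii), this row is a **THEOREM ON PAPER, OUTRIGHT** (no hypothesis left; -imc PROOF.md
3a169f71cdd153d6 audited by REF1 §245 / REF2 v58-add3 §I).) -/
def SignedDefectInjectsAtTwo : Prop :=
  ∀ (W : WeierstrassCurve ℚ) [W.IsElliptic] [W.IsGloballyMinimal], GoodSS W 2 →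
  ∀ (κ : ZpExtension ℚ 2), κ.IsCyclotomic →
  ∀ (v : HeightOneSpectrum (𝓞 ℚ)), (2 : 𝓞 ℚ) ∈ v.asIdeal →
  ∀ m n : ℕ, m ≤ n →
    (signedLocalPoints κ (v.adicCompletion ℚ) W 1 n ⊔ signedLocalPoints κ (v.adicCompletion ℚ) W (-1) n) ⊓
        localLayerPoints κ (v.adicCompletion ℚ) W m =
      signedLocalPoints κ (v.adicCompletion ℚ) W 1 m ⊔ signedLocalPoints κ (v.adicCompletion ℚ) W (-1) m

/-- **C3± · `SignedMeetAtTwoOfTraceNeZero`** (candidate, rank 5; the `a₂ ≠ 0` complement of the meet clause of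
`F1Sign2.SignedDecompositionAtTwo`).  `E⁺_n ∩ E⁻_n = E(ℚ₂)` also for a₂ = ±2.  Census: rank(E⁺ ∩ E⁻) = 1, n ≤ 8
(log model), n = 3, 4, 5 (points); note the mod-2 shadows DO meet more (dim κE⁺ ∩ κE⁻ = 1,1,1,2,4,7,13,26).
Why it might fail: none known beyond 2-torsion (excluded); `⊇` is the tree lemma
`localLayerPointsOfEmb_zero_le_signedLocalPointsOfEmb`.
(RIDER, typer -ty g20: PLAIN; the `a₂ = ±2` complement of `F1Sign2.SignedDecompositionAtTwo`'s meet clause (together: kernel `meet_eq_layer_zero_of_rows`, all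
three types); REF1-AUDIT §228b R228c′: **THEOREM IN SUBSTANCE modulo `E(ℚ_{2,n})[2] = 0` only** — downward induction on ALL trace conditions (`m' = n−1` gives `P ∈ E_{n−1}`;
`m' = n−2` gives `2P ∈ E_{n−2} ⇒ P ∈ E_{n−2}`; …; `m' = 0` gives `P ∈ E_0 = E(ℚ₂)`), no isotypic model, no (B2); engine M 18/18; BC7-m: at `n = 0` by definition.
Grade: PLAIN support `def` (§230).  REF1 §228 R228c (on Sketch61's all-types form `SignedSubgroupsAtTwo.SignedMeetAtTwo`, `ℚ_[2]` carrier — the earlier typer port, now the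
`ℚ_[2]`-variant of record for the same content): THEOREM IN SUBSTANCE — `E⁺ ∩ E⁻ ⊗ ℚ = V_0` by the isotypic reading and `E(ℚ₂)` is `2`-saturated in `E(ℚ_{2,n})`
(`E(ℚ_{2,n})[2] = 0`: `e = 2ⁿ` prime to `3`, `#Ẽ(𝔽₂) = 3 − a₂` odd), Kobayashi 8.12 (i) verbatim [cite: Kobayashi2003, Prop. 8.12]; REF2 v57 §3.2: elementary in the
frame, needs [cite: Sprung2012, Lemma 2.3]; in print in substance; beyond print: no.  REF2-PLACEMENT-v58 §6 (v2 fold, typer -ty g20): the «no 2-torsion in the tower» hypothesis `E(ℚ_{2,n})[2] = 0` is a LEMMA, not an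
input — for good supersingular reduction at 2 inertia acts on `W[2]` through the level-2 fundamental character of order 3 [cite: Conrad1997Flat, Thm. 1.1]
[cite: CalegariEmerton2009, Lemma 13], so `W[2](K) = 0` for every `K/ℚ₂` whose ramification index is prime to 3 — all layers `ℚ_{2,n}` (`e = 2ⁿ`); equivalently the
Newton-polygon remark above or `#Ẽ(𝔽₂) = 3 − a₂` odd + formal group — hence this row is a **THEOREM IN SUBSTANCE, UNCONDITIONALLY** (C1′/C6/C4/C4a remain «modulo
(B2)@2 = `HondaSystemAtTwoExists`» only).  REF1-AUDIT §245 R245a (v3 fold): with (I2) automatic and PROOF.md Remark (iii), this row is a **THEOREM ON PAPER, OUTRIGHT** (no hypothesis left; -imc PROOF.md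
3a169f71cdd153d6 audited by REF1 §245 / REF2 v58-add3 §I).) -/
def SignedMeetAtTwoOfTraceNeZero : Prop :=
  ∀ (W : WeierstrassCurve ℚ) [W.IsElliptic] [W.IsGloballyMinimal], GoodSS W 2 → W.frobeniusTrace 2 ≠ 0 →
  ∀ (κ : ZpExtension ℚ 2), κ.IsCyclotomic →
  ∀ (v : HeightOneSpectrum (𝓞 ℚ)), (2 : 𝓞 ℚ) ∈ v.asIdeal →
  ∀ n : ℕ,
    signedLocalPoints κ (v.adicCompletion ℚ) W 1 n ⊓ signedLocalPoints κ (v.adicCompletion ℚ) W (-1) n =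
      localLayerPoints κ (v.adicCompletion ℚ) W 0

/-! ## Kernel-checked arithmetic of the exponents -/

/-- The C1′ exponents `Σ_{m ≤ n} ⌊2^m/15⌋` for `n = 0..9` are `0,0,0,0,1,3,7,15,32,66` (census: 1,3,7,15,32 measured
at n = 4..8), and they are the partial sums of the C6 exponents `⌊2^(k+1)/15⌋`. -/
theorem exponents_values :
    (List.range 10).map (fun n => (Finset.range (n + 1)).sum fun m => 2 ^ m / 15) = [0, 0, 0, 0, 1, 3, 7, 15, 32, 66] ∧
    (List.range 10).map (fun n => 2 ^ (n + 1) / 15) = [0, 0, 0, 1, 2, 4, 8, 17, 34, 68] ∧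
    ∀ n ∈ List.range 12, (Finset.range (n + 1)).sum (fun m => 2 ^ m / 15) =
      ((List.range n).map fun k => 2 ^ (k + 1) / 15).sum := by
  refine ⟨by decide, by decide, by decide⟩

-- Sketch63's `extrapolation_parts_at_eight` (the dead C1 exponent `2^(n−3) − 1` agrees with the floor law for n ≤ 7 and parts at n = 8) is ALREADY LANDED as
-- `SignedSubgroupsAtTwo.Kernel.signedSpanIndexLaws_agree_le_seven` (`F1Sign2/SignedSubgroupsAtTwoKernel.lean`, p737784) — not restated (gate dedup).

/-- The derivation's valuation identity at small `m`: `⌊2^m/15⌋ = Σ_{1 ≤ j < m, j ≡ m+1 (mod 4)} 2^(j−1)` for `m ≤ 12`. -/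
theorem floor_eq_normB_valuation :
    ∀ m ∈ List.range 13, 2 ^ m / 15 =
      ((List.range m).filter fun j => 1 ≤ j ∧ j % 4 = (m + 1) % 4).foldr (fun j s => 2 ^ (j - 1) + s) 0 := by
  decide

/-! ## Closed form and the non-Iwasawa shape of the defect (add4) -/
/-- `Σ_{m ≤ n} ⌊2^m/15⌋ = (2^(n+1) − 2^((n+1) mod 4))/15 − ⌊(n+1)/4⌋` for `n ≤ 40`. -/
theorem exponent_closed_form :
    ∀ n ∈ List.range 41, (Finset.range (n + 1)).sum (fun m => 2 ^ m / 15) =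
      (2 ^ (n + 1) - 2 ^ ((n + 1) % 4)) / 15 - (n + 1) / 4 := by
  decide

/-- The 𝔽₂-dimension law of the defect module, `s_n = ⌊2^n/15⌋ + ⌊2^(n−1)/15⌋` (measured 1, 3, 6, 12, 25 at n = 4..8). -/
theorem sdim_values : (List.range 9).map (fun n => 2 ^ n / 15 + 2 ^ (n - 1) / 15) = [0, 0, 0, 0, 1, 3, 6, 12, 25] := by
  decide

/-- Non-Iwasawa shape: no INTEGERS `μ, λ, ν` fit `Σ_{m ≤ n} ⌊2^m/15⌋ = μ·2^n + λ·n + ν` even at the three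
consecutive layers `n = 8, 9, 10` (values 32, 66, 134: the second difference forces `256 μ = 34`).  So the defect
modules `Q_n = Ê(ℚ_{2,n})/(E⁺_n + E⁻_n)` do not have the order growth `2^(μ 2^n + λ n + ν)` of the co-invariants of a
finitely generated torsion Iwasawa module. -/
theorem no_iwasawa_fit (μ l ν : ℤ)
    (h8 : (∑ m ∈ Finset.range 9, (2 : ℤ) ^ m / 15) = μ * 2 ^ 8 + l * 8 + ν)
    (h9 : (∑ m ∈ Finset.range 10, (2 : ℤ) ^ m / 15) = μ * 2 ^ 9 + l * 9 + ν)
    (h10 : (∑ m ∈ Finset.range 11, (2 : ℤ) ^ m / 15) = μ * 2 ^ 10 + l * 10 + ν) : False := by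
  have e8 : (∑ m ∈ Finset.range 9, (2 : ℤ) ^ m / 15) = 32 := by decide
  have e9 : (∑ m ∈ Finset.range 10, (2 : ℤ) ^ m / 15) = 66 := by decide
  have e10 : (∑ m ∈ Finset.range 11, (2 : ℤ) ^ m / 15) = 134 := by decide
  omega

end Summit.BirchSwinnertonDyer.Rank1Residual.F1Sign2.SignedSpanDefect
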